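import Literature.NumberTheory.Sieve.FGKMT2018Prop91Reduction
import Literature.NumberTheory.Sieve.FGKMT2018MainTermPrefactor
import Literature.NumberTheory.Sieve.Maynard2016Lemma85
import HarnessLib

/-!
# Maynard 2016, Prop. 9.1 / FGKMT 2018, Thm 6: the constant `Π` of Lemma 8.4 in (9.4)

Source: J. Maynard, *Dense clusters of primes in subsets*, Compositio Math. 152 (2016),
proof of Proposition 9.1, display (9.4) p. 20: applying Lemma 8.4 to `Σ_r y_r²/φ_ω(r)` (moduli
`W_j`, `g(p) = p − ω(p)`) produces the Euler product
`Π = ∏_{p ∤ WB} (1 + ω(p)/(p − ω(p)))(1 − 1/p)^k ≍ 𝔖_{WB}(𝓛)^{-1}`, «the singular series cancel».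
K. Ford, B. Green, S. Konyagin, J. Maynard, T. Tao, *Long gaps between primes*, J. Amer. Math. Soc. 31
(2018), Thm 6 pp. 21–22 (the case `𝒜 = ℤ`).

In the tree's conventions (`FGKMT2018YSquareSumBridge`: the moduli `idxMod L B R j = W_j` only record the
index choices at primes `p ≤ ⌊R⌋`), the recursion constant `MaynardDense.piRec k (idxMod L B R) (p ↦ p − ω(p))`
of `MaynardDense.lemma84_all_dec` is identified exactly:
`(WB)^k/φ(WB)^k · 𝔖_{WB}(𝓛) · Π = ∏_{p ∣ E, p > ⌊R⌋, p ∤ WB} (1 + (k − ω(p))/p)` (`excProd`), where `E` is any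
exceptional modulus (`ω(p) = k` for `p ∤ E`, Lemma 8.1); the right side is `1 + O(1/log X)` in the frame of
Prop. 6.1 (`prop91_excProd_frame`). Also: `W_j ≤ W·B·E` (the size input for the `L ≪ log log R` hypothesis of
Lemma 8.4).
-/

open Finset Filter Real
open scoped Topology

namespace Literature.NumberTheory.Sieve.FGKMT2018

variable {k : ℕ}

/-! ### The free indices at primes beyond `R`, and the size of `W_j` -/

/-- A prime `p > ⌊R⌋` with `p ∤ WB` divides no `W_j`.
[cite: Maynard2016DenseClusters, §7 p. 13 (definition of the W_j); FordGreenKonyaginMaynardTao2018, (7.5) p. 21] -/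
theorem not_dvd_idxMod_of_lt (L : Fin k → ℤ × ℤ) (B : ℕ) {R : ℝ} (j : Fin k) {p : ℕ} (hp : p.Prime)
    (hpW : ¬ p ∣ wCut k B * B) (hpR : ⌊R⌋₊ < p) : ¬ p ∣ idxMod L B R j := by
  classical
  unfold idxMod
  rw [hp.dvd_mul, (Nat.prime_iff.1 hp).dvd_finsetProd_iff]
  rintro (h | ⟨q, hq, hpq⟩)
  · exact hpW h
  · obtain ⟨hqr, hqp, -, -⟩ := Finset.mem_filter.1 hq
    have : p = q := (Nat.prime_dvd_prime_iff_eq hp hqp).1 hpq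
    subst this
    have := Finset.mem_range.1 hqr
    omega

/-- For a prime `p > ⌊R⌋` with `p ∤ WB` all `k` indices are free: `n(p) = #{j : p ∤ W_j} = k`, so the Euler
factor of `Π` at such `p` is `(1 + k/(p − ω(p)))(1 − 1/p)^k`.
[cite: Maynard2016DenseClusters, Lemma 8.4 (definition of n(p)) p. 16, proof of Prop. 9.1 (9.4) p. 20] -/
theorem nW_idxMod_eq_card_of_lt (L : Fin k → ℤ × ℤ) (B : ℕ) (R : ℝ) {p : ℕ} (hp : p.Prime)
    (hpW : ¬ p ∣ wCut k B * B) (hpR : ⌊R⌋₊ < p) : MaynardDense.nW k (idxMod L B R) p = k := by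
  classical
  unfold MaynardDense.nW
  have h : ∀ i : Fin k, (if p ∣ idxMod L B R i then 0 else 1) = (1 : ℕ) := fun i =>
    if_neg (not_dvd_idxMod_of_lt L B i hp hpW hpR)
  rw [Finset.sum_congr rfl fun i _ => h i]
  simp

/-- If a prime `p ∤ WB` divides some `W_j`, then `p ≤ ⌊R⌋` and `j` is not an admissible index at `p`, whence
`ω_𝓛(p) < k` (for `ω(p) = k` every index is admissible).
[cite: Maynard2016DenseClusters, §7 p. 13, Lemma 8.1 p. 15] -/
theorem omegaL_lt_of_dvd_idxMod {L : Fin k → ℤ × ℤ} (hadm : FormsAdmissible L) {B : ℕ} {R : ℝ}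
    {j : Fin k} {p : ℕ} (hp : p.Prime) (hpW : ¬ p ∣ wCut k B * B) (h : p ∣ idxMod L B R j) :
    omegaL L p < k := by
  classical
  have hpR : p ≤ ⌊R⌋₊ := by
    by_contra hlt
    exact not_dvd_idxMod_of_lt L B j hp hpW (lt_of_not_ge hlt) h
  have hj : j ∉ admIdx L p := (prime_dvd_idxMod_iff hp hpW hpR).1 h
  rw [← card_admIdx hadm hp]
  have hss : admIdx L p ⊂ Finset.univ :=
    Finset.ssubset_univ_iff.2 fun heq => hj (heq ▸ Finset.mem_univ j)
  simpa using Finset.card_lt_card hss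

/-- **Size of the moduli**: `W_j ≤ W·B·E` for any exceptional modulus `E` (`ω(p) = k` for `p ∤ E`): beyond `WB`,
`W_j` is a product of distinct primes at which `ω(p) < k`, all dividing `E`.
[cite: Maynard2016DenseClusters, §7 p. 13, Lemma 8.1 p. 15 (ω(p) = k for p ∤ ∏ a_i ∏ (a_ib_j − b_ia_j))] -/
theorem idxMod_le_mul_exceptional {L : Fin k → ℤ × ℤ} (hadm : FormsAdmissible L) (B : ℕ) (R : ℝ)
    (j : Fin k) {E : ℕ} (hE0 : E ≠ 0) (hE : ∀ p : ℕ, p.Prime → ¬ p ∣ E → omegaL L p = k) :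
    idxMod L B R j ≤ wCut k B * B * E := by
  classical
  have hdiv : ∀ p ∈ (Finset.range (⌊R⌋₊ + 1)).filter
      (fun p => p.Prime ∧ ¬ p ∣ wCut k B * B ∧ j ∉ admIdx L p), p ∈ E.primeFactors := by
    intro p hp
    obtain ⟨hpr, hpp, hpW, hj⟩ := Finset.mem_filter.1 hp
    have hpR : p ≤ ⌊R⌋₊ := by have := Finset.mem_range.1 hpr; omega
    have hdvd : p ∣ idxMod L B R j := (prime_dvd_idxMod_iff hpp hpW hpR).2 hj
    have hlt := omegaL_lt_of_dvd_idxMod hadm hpp hpW hdvd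
    by_contra hpE
    have hpE' : ¬ p ∣ E := fun h => hpE (Nat.mem_primeFactors.2 ⟨hpp, h, hE0⟩)
    exact absurd (hE p hpp hpE') hlt.ne
  unfold idxMod
  refine Nat.mul_le_mul_left _ (Nat.le_of_dvd (Nat.pos_of_ne_zero hE0) ?_)
  exact (Finset.prod_dvd_prod_of_subset _ _ (fun p => p) hdiv).trans (Nat.prod_primeFactors_dvd E)

/-! ### The Euler factors of `𝔖_{WB}(𝓛) · Π` -/

/-- At a prime `p ∤ WB` with `p ≤ ⌊R⌋` the Euler factors of `𝔖_{WB}(𝓛)` and `Π` cancel: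
`(1 − ω/p)(1 − 1/p)^{-k} · (1 + ω/(p − ω))(1 − 1/p)^k = 1`.
[cite: Maynard2016DenseClusters, proof of Prop. 9.1 (9.4) p. 20 («∏_{p∤WB}(1 + ω(p)/(p−ω(p)))(1−1/p)^k ≪ 𝔖_{WB}(𝓛)^{-1}»)] -/
theorem singFactor_mul_piFactor_eq_one (L : Fin k → ℤ × ℤ) {p : ℕ} (hp : 2 ≤ p)
    (hω : omegaL L p < p) :
    singFactor L p * ((1 + (omegaL L p : ℝ) / ((p : ℝ) - omegaL L p)) * (1 - 1 / (p : ℝ)) ^ k) = 1 := by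
  unfold singFactor
  have hp0 : (0 : ℝ) < p := by exact_mod_cast (by omega : 0 < p)
  have hpω : (0 : ℝ) < (p : ℝ) - omegaL L p := by
    have : ((omegaL L p : ℕ) : ℝ) < p := by exact_mod_cast hω
    linarith
  have h1 : (1 : ℝ) - 1 / p ≠ 0 := by
    have hp1 : (1 : ℝ) < p := by exact_mod_cast (by omega : 1 < p)
    have : (0 : ℝ) < 1 - 1 / p := by rw [sub_pos, div_lt_one hp0]; exact hp1
    exact this.ne'
  have hA : (1 - (omegaL L p : ℝ) / p) * (1 + (omegaL L p : ℝ) / ((p : ℝ) - omegaL L p)) = 1 := by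
    field_simp
    ring
  calc _ = ((1 - (omegaL L p : ℝ) / p) * (1 + (omegaL L p : ℝ) / ((p : ℝ) - omegaL L p))) *
        (((1 - 1 / (p : ℝ))⁻¹ * (1 - 1 / (p : ℝ))) ^ k) := by rw [mul_pow]; ring
    _ = 1 := by rw [hA, inv_mul_cancel₀ h1, one_pow, one_mul]

/-- At a prime `p ∤ WB` with `p > ⌊R⌋` (all indices free):
`(1 − ω/p)(1 − 1/p)^{-k} · (1 + k/(p − ω))(1 − 1/p)^k = 1 + (k − ω(p))/p` (`= 1` when `ω(p) = k`).
[cite: Maynard2016DenseClusters, proof of Prop. 9.1 (9.4) p. 20; Lemma 8.4 (n(p)) p. 16] -/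
theorem singFactor_mul_piFactor_eq (L : Fin k → ℤ × ℤ) {p : ℕ} (hp : 2 ≤ p) (hω : omegaL L p < p) :
    singFactor L p * ((1 + (k : ℝ) / ((p : ℝ) - omegaL L p)) * (1 - 1 / (p : ℝ)) ^ k) =
      1 + ((k : ℝ) - omegaL L p) / p := by
  unfold singFactor
  have hp0 : (0 : ℝ) < p := by exact_mod_cast (by omega : 0 < p)
  have hpω : (0 : ℝ) < (p : ℝ) - omegaL L p := by
    have : ((omegaL L p : ℕ) : ℝ) < p := by exact_mod_cast hω
    linarith
  have h1 : (1 : ℝ) - 1 / p ≠ 0 := by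
    have hp1 : (1 : ℝ) < p := by exact_mod_cast (by omega : 1 < p)
    have : (0 : ℝ) < 1 - 1 / p := by rw [sub_pos, div_lt_one hp0]; exact hp1
    exact this.ne'
  have hA : (1 - (omegaL L p : ℝ) / p) * (1 + (k : ℝ) / ((p : ℝ) - omegaL L p)) =
      1 + ((k : ℝ) - omegaL L p) / p := by
    field_simp
    ring
  calc _ = ((1 - (omegaL L p : ℝ) / p) * (1 + (k : ℝ) / ((p : ℝ) - omegaL L p))) *
        (((1 - 1 / (p : ℝ))⁻¹ * (1 - 1 / (p : ℝ))) ^ k) := by rw [mul_pow]; ring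
    _ = 1 + ((k : ℝ) - omegaL L p) / p := by rw [hA, inv_mul_cancel₀ h1, one_pow, mul_one]

/-- `∏_{p ∣ D} (1 − 1/p)^k = (φ(D)/D)^k` over `ℝ` (Euler's product for `φ`). [folklore] -/
private theorem prod_primeFactors_one_sub_inv_pow {D : ℕ} (hD : D ≠ 0) :
    ∏ p ∈ D.primeFactors, (1 - 1 / (p : ℝ)) ^ k = ((Nat.totient D : ℝ) / (D : ℕ)) ^ k := by
  rw [Finset.prod_pow]
  congr 1
  have h := congrArg (fun q : ℚ => (q : ℝ)) (Nat.totient_eq_mul_prod_factors D)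
  push_cast at h
  have hD' : ((D : ℕ) : ℝ) ≠ 0 := by exact_mod_cast hD
  rw [h, mul_div_cancel_left₀ _ hD']
  exact Finset.prod_congr rfl fun p _ => by rw [one_div]

/-- The exceptional Euler factors of `𝔖_{WB}(𝓛)·Π` beyond `R`:
`excProd 𝓛 D N E = ∏_{p ∣ E, p > N, p ∤ D} (1 + (k − ω_𝓛(p))/p)`.
[cite: Maynard2016DenseClusters, proof of Prop. 9.1 (9.4) p. 20; Lemma 8.1 p. 15] -/
noncomputable def excProd (L : Fin k → ℤ × ℤ) (D N E : ℕ) : ℝ :=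
  ∏ p ∈ E.primeFactors.filter (fun p => N < p ∧ ¬ p ∣ D), (1 + ((k : ℝ) - omegaL L p) / p)

/-- `excProd ≥ 1` (`ω(p) ≤ k` for admissible `𝓛`). [cite: Maynard2016DenseClusters, §7 p. 13 (ω(p) ≤ k)] -/
theorem one_le_excProd {L : Fin k → ℤ × ℤ} (hadm : FormsAdmissible L) (D N E : ℕ) :
    1 ≤ excProd L D N E := by
  unfold excProd
  refine Finset.one_le_prod fun p hp => ?_
  have hpp : p.Prime := (Nat.mem_primeFactors.1 (Finset.mem_filter.1 hp).1).1
  have hω : ((omegaL L p : ℕ) : ℝ) ≤ k := by exact_mod_cast omegaL_le_card_of_admissible hadm hpp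
  have hp0 : (0 : ℝ) < p := by exact_mod_cast hpp.pos
  have : 0 ≤ ((k : ℝ) - omegaL L p) / p := div_nonneg (by linarith) hp0.le
  linarith

/-- `excProd ≤ exp(k · #{p ∣ E : p > N}/(N + 1))` (each factor is `≤ 1 + k/(N+1) ≤ e^{k/(N+1)}`).
[cite: Maynard2016DenseClusters, Lemma 8.1 p. 15 (few exceptional primes)] -/
theorem excProd_le_exp {L : Fin k → ℤ × ℤ} (hadm : FormsAdmissible L) (D N E : ℕ) :
    excProd L D N E ≤
      Real.exp ((k : ℝ) * #(E.primeFactors.filter (fun p => N < p)) / ((N : ℝ) + 1)) := by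
  unfold excProd
  set S := E.primeFactors.filter (fun p => N < p ∧ ¬ p ∣ D) with hS
  set c : ℝ := Real.exp ((k : ℝ) / ((N : ℝ) + 1)) with hc
  have hNpos : (0 : ℝ) < (N : ℝ) + 1 := by positivity
  have hc1 : 1 ≤ c := Real.one_le_exp (by positivity)
  have h0 : ∀ p ∈ S, (0 : ℝ) ≤ 1 + ((k : ℝ) - omegaL L p) / p := fun p hp => by
    have hpp : p.Prime := (Nat.mem_primeFactors.1 (Finset.mem_filter.1 hp).1).1
    have hω : ((omegaL L p : ℕ) : ℝ) ≤ k := by exact_mod_cast omegaL_le_card_of_admissible hadm hpp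
    have hp0 : (0 : ℝ) < p := by exact_mod_cast hpp.pos
    have : 0 ≤ ((k : ℝ) - omegaL L p) / p := div_nonneg (by linarith) hp0.le
    linarith
  have hle : ∀ p ∈ S, 1 + ((k : ℝ) - omegaL L p) / p ≤ c := fun p hp => by
    obtain ⟨hpE, hNp, -⟩ := Finset.mem_filter.1 hp
    have hpp := (Nat.mem_primeFactors.1 hpE).1
    have hp1 : (N : ℝ) + 1 ≤ p := by exact_mod_cast hNp
    have hp0 : (0 : ℝ) < p := by exact_mod_cast hpp.pos
    have h1 : ((k : ℝ) - omegaL L p) / p ≤ (k : ℝ) / ((N : ℝ) + 1) := by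
      have hω0 : (0 : ℝ) ≤ omegaL L p := Nat.cast_nonneg _
      calc ((k : ℝ) - omegaL L p) / p ≤ (k : ℝ) / p :=
            div_le_div_of_nonneg_right (by linarith) hp0.le
        _ ≤ (k : ℝ) / ((N : ℝ) + 1) := div_le_div_of_nonneg_left (Nat.cast_nonneg k) hNpos hp1
    calc 1 + ((k : ℝ) - omegaL L p) / p ≤ (k : ℝ) / ((N : ℝ) + 1) + 1 := by linarith
      _ ≤ c := Real.add_one_le_exp _
  have hsub : S ⊆ E.primeFactors.filter (fun p => N < p) := fun p hp => by
    obtain ⟨hpE, hNp, -⟩ := Finset.mem_filter.1 hp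
    exact Finset.mem_filter.2 ⟨hpE, hNp⟩
  calc ∏ p ∈ S, (1 + ((k : ℝ) - omegaL L p) / p) ≤ ∏ p ∈ S, c := Finset.prod_le_prod h0 hle
    _ = c ^ #S := Finset.prod_const c
    _ ≤ c ^ #(E.primeFactors.filter (fun p => N < p)) :=
        pow_le_pow_right₀ hc1 (Finset.card_le_card hsub)
    _ = Real.exp ((k : ℝ) * #(E.primeFactors.filter (fun p => N < p)) / ((N : ℝ) + 1)) := by
        rw [hc, ← Real.exp_nat_mul]
        congr 1
        ring

/-- **The partial products of `𝔖_{WB}(𝓛)·Π` stabilise**: for `y ≥ max(WB, E)`,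
`𝔖_{WB}(𝓛; p ≤ y) · Π(p ≤ y) = (φ(WB)/WB)^k · excProd` — at `p ∣ WB` the factor of `Π` is `(1 − 1/p)^k`
(`n(p) = 0`), at `p ∤ WB`, `p ≤ ⌊R⌋` the factors cancel (`n(p) = ω(p)`), and at `p ∤ WB`, `p > ⌊R⌋` the product
is `1 + (k − ω(p))/p` (`n(p) = k`), which is `1` unless `p ∣ E`.
[cite: Maynard2016DenseClusters, proof of Prop. 9.1 (9.4) p. 20 («the singular series cancel»); Lemma 8.4 p. 16] -/
theorem singPartial_mul_piPartial_eq {L : Fin k → ℤ × ℤ} (hadm : FormsAdmissible L) {B : ℕ} (hB : B ≠ 0)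
    (R : ℝ) {E : ℕ} (hE0 : E ≠ 0) (hE : ∀ p : ℕ, p.Prime → ¬ p ∣ E → omegaL L p = k) {y : ℕ}
    (hyW : wCut k B * B ≤ y) (hyE : E ≤ y) :
    singPartial L (wCut k B * B) y *
        MaynardDense.piPartial k (idxMod L B R) (fun p => (p : ℝ) - omegaL L p) (y + 1) =
      ((Nat.totient (wCut k B * B) : ℝ) / (wCut k B * B : ℕ)) ^ k * excProd L (wCut k B * B) ⌊R⌋₊ E := by
  classical
  have hD0 : wCut k B * B ≠ 0 := Nat.mul_ne_zero (wCut_ne_zero k B) hB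
  have hω : ∀ p, p.Prime → omegaL L p < p := fun p hp => ((formsAdmissible_iff_omegaL L).1 hadm).2 p hp
  set T := (Finset.range (y + 1)).filter Nat.Prime with hT
  have hpb : Nat.primesBelow (y + 1) = T := by
    ext p; rw [Nat.mem_primesBelow, hT, Finset.mem_filter, Finset.mem_range]
  have hsing : singPartial L (wCut k B * B) y =
      ∏ p ∈ T.filter (fun p => ¬ p ∣ wCut k B * B), singFactor L p := by
    unfold singPartial
    refine Finset.prod_congr ?_ fun _ _ => rfl
    ext p
    simp only [hT, Finset.mem_filter, Finset.mem_range, and_assoc]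
  -- Step 1: one product over `T`
  have hprod : singPartial L (wCut k B * B) y *
      MaynardDense.piPartial k (idxMod L B R) (fun p => (p : ℝ) - omegaL L p) (y + 1) =
      ∏ p ∈ T, (if p ∣ wCut k B * B then (1 - 1 / (p : ℝ)) ^ k else
        if p ≤ ⌊R⌋₊ then 1 else 1 + ((k : ℝ) - omegaL L p) / p) := by
    rw [hsing, MaynardDense.piPartial, hpb, Finset.prod_filter, ← Finset.prod_mul_distrib]
    refine Finset.prod_congr rfl fun p hp => ?_
    have hpp : p.Prime := (Finset.mem_filter.1 hp).2
    by_cases hpD : p ∣ wCut k B * B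
    · rw [if_neg (not_not.2 hpD), if_pos hpD, nW_idxMod_eq_zero L R hpD]
      simp
    · rw [if_pos hpD, if_neg hpD]
      by_cases hpR : p ≤ ⌊R⌋₊
      · rw [if_pos hpR, nW_idxMod_eq_omegaL hadm hpp hpD hpR]
        exact singFactor_mul_piFactor_eq_one L hpp.two_le (hω p hpp)
      · rw [if_neg hpR, nW_idxMod_eq_card_of_lt L B R hpp hpD (lt_of_not_ge hpR)]
        exact singFactor_mul_piFactor_eq L hpp.two_le (hω p hpp)
  -- Step 2: split `T` according to `p ∣ WB`
  rw [hprod, ← Finset.prod_filter_mul_prod_filter_not T (fun p => p ∣ wCut k B * B)]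
  congr 1
  · have hTD : T.filter (fun p => p ∣ wCut k B * B) = (wCut k B * B).primeFactors := by
      ext p
      rw [Finset.mem_filter, hT, Finset.mem_filter, Finset.mem_range, Nat.mem_primeFactors]
      constructor
      · rintro ⟨⟨-, hpp⟩, hpd⟩; exact ⟨hpp, hpd, hD0⟩
      · rintro ⟨hpp, hpd, -⟩
        exact ⟨⟨Nat.lt_succ_of_le ((Nat.le_of_dvd (Nat.pos_of_ne_zero hD0) hpd).trans hyW), hpp⟩, hpd⟩
    rw [hTD, ← prod_primeFactors_one_sub_inv_pow hD0]
    exact Finset.prod_congr rfl fun p hp => by rw [if_pos (Nat.dvd_of_mem_primeFactors hp)]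
  · unfold excProd
    have hS : E.primeFactors.filter (fun p => ⌊R⌋₊ < p ∧ ¬ p ∣ wCut k B * B) ⊆
        T.filter (fun p => ¬ p ∣ wCut k B * B) := by
      intro p hp
      obtain ⟨hpE, -, hpD⟩ := Finset.mem_filter.1 hp
      obtain ⟨hpp, hpd, -⟩ := Nat.mem_primeFactors.1 hpE
      refine Finset.mem_filter.2 ⟨?_, hpD⟩
      rw [hT, Finset.mem_filter, Finset.mem_range]
      exact ⟨Nat.lt_succ_of_le ((Nat.le_of_dvd (Nat.pos_of_ne_zero hE0) hpd).trans hyE), hpp⟩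
    rw [← Finset.prod_subset hS ?_]
    · refine Finset.prod_congr rfl fun p hp => ?_
      obtain ⟨-, hpR, hpD⟩ := Finset.mem_filter.1 hp
      rw [if_neg hpD, if_neg (not_le.2 hpR)]
    · intro p hpT hpS
      obtain ⟨hpT', hpD⟩ := Finset.mem_filter.1 hpT
      have hpp : p.Prime := by rw [hT] at hpT'; exact (Finset.mem_filter.1 hpT').2
      rw [if_neg hpD]
      by_cases hpR : p ≤ ⌊R⌋₊
      · rw [if_pos hpR]
      · rw [if_neg hpR]
        have hpE : ¬ p ∣ E := fun h =>
          hpS (Finset.mem_filter.2 ⟨Nat.mem_primeFactors.2 ⟨hpp, h, hE0⟩, lt_of_not_ge hpR, hpD⟩)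
        rw [hE p hpp hpE]
        simp

/-- **`Π` identified** («the singular series cancel»): for `2 ≤ k`, admissible non-degenerate `𝓛`, `B ≠ 0` and any
exceptional modulus `E` (`ω(p) = k` for `p ∤ E`), the constant `Π` of Lemma 8.4 for the moduli `W_j` and
`g(p) = p − ω(p)` satisfies `(WB)^k/φ(WB)^k · 𝔖_{WB}(𝓛) · Π = ∏_{p ∣ E, p > ⌊R⌋, p ∤ WB} (1 + (k − ω(p))/p)`.
[cite: Maynard2016DenseClusters, proof of Prop. 9.1 (9.4) p. 20; Lemma 8.4 (Π_g = ∏_p (1 + n(p)/g(p))(1 − 1/p)^r) p. 16; FordGreenKonyaginMaynardTao2018, Thm 6 (7.12) p. 21] -/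
theorem prefactor_mul_piRec_eq (hk : 2 ≤ k) {L : Fin k → ℤ × ℤ} (hadm : FormsAdmissible L)
    (hnd : FormsNondegenerate L) {B : ℕ} (hB : B ≠ 0) (R : ℝ) {E : ℕ} (hE0 : E ≠ 0)
    (hE : ∀ p : ℕ, p.Prime → ¬ p ∣ E → omegaL L p = k) :
    ((wCut k B * B : ℕ) : ℝ) ^ k / (Nat.totient (wCut k B * B) : ℝ) ^ k *
        singSeriesExcl L (wCut k B * B) *
        MaynardDense.piRec k (idxMod L B R) (fun p => (p : ℝ) - omegaL L p) =
      excProd L (wCut k B * B) ⌊R⌋₊ E := by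
  have hD0 : wCut k B * B ≠ 0 := Nat.mul_ne_zero (wCut_ne_zero k B) hB
  have hω : ∀ p, p.Prime → omegaL L p < p := fun p hp => ((formsAdmissible_iff_omegaL L).1 hadm).2 p hp
  have hk' : (2 : ℝ) ≤ k := by exact_mod_cast hk
  -- convergence of the partial products of `Π` (decoupled hypotheses: `K₀ = k`, `K₁ = 2k − 1`)
  have hT1 : Tendsto (MaynardDense.piPartial k (idxMod L B R) (fun p => (p : ℝ) - omegaL L p)) atTop
      (𝓝 (MaynardDense.piRec k (idxMod L B R) (fun p => (p : ℝ) - omegaL L p))) := by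
    refine MaynardDense.tendsto_piPartial_dec k (idxMod L B R) k (2 * (k : ℝ) - 1) _ hk'
      (by nlinarith) (fun i => idxMod_ne_zero L hB R i) (fun i p hp hple => ?_) (fun p hp => ?_)
      (fun p hp => ?_)
    · have : p ≤ 2 * k ^ 2 := by exact_mod_cast hple
      exact dvd_idxMod_of_le L B R i hp this
    · have : ((omegaL L p : ℕ) : ℝ) < p := by exact_mod_cast hω p hp
      show (0 : ℝ) < (p : ℝ) - omegaL L p
      linarith
    · have h1 : ((omegaL L p : ℕ) : ℝ) ≤ k := by exact_mod_cast omegaL_le_card_of_admissible hadm hp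
      show |1 + ((p : ℝ) - omegaL L p) - p| + (k : ℝ) ≤ 2 * (k : ℝ) - 1
      rw [show (1 : ℝ) + ((p : ℝ) - omegaL L p) - p = 1 - omegaL L p by ring]
      rcases Nat.eq_zero_or_pos (omegaL L p) with h0 | hpos
      · rw [h0, Nat.cast_zero, sub_zero, abs_one]
        linarith
      · have : (1 : ℝ) ≤ omegaL L p := by exact_mod_cast hpos
        rw [abs_of_nonpos (by linarith)]
        linarith
  have hT := (tendsto_singPartial_of_nondegenerate hadm hnd (wCut k B * B)).mul
    (hT1.comp (tendsto_add_atTop_nat 1))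
  -- the product sequence is eventually the constant `(φ(WB)/WB)^k · excProd`
  have hconst : (fun _ : ℕ => ((Nat.totient (wCut k B * B) : ℝ) / (wCut k B * B : ℕ)) ^ k *
      excProd L (wCut k B * B) ⌊R⌋₊ E) =ᶠ[atTop] fun y => singPartial L (wCut k B * B) y *
      (MaynardDense.piPartial k (idxMod L B R) (fun p => (p : ℝ) - omegaL L p) ∘ fun a => a + 1) y := by
    filter_upwards [eventually_ge_atTop (max (wCut k B * B) E)] with y hy
    rw [Function.comp_apply,
      singPartial_mul_piPartial_eq hadm hB R hE0 hE (le_of_max_le_left hy) (le_of_max_le_right hy)]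
  have hlim := tendsto_nhds_unique hT (tendsto_const_nhds.congr' hconst)
  have hDpos : (0 : ℝ) < ((wCut k B * B : ℕ) : ℝ) := by exact_mod_cast Nat.pos_of_ne_zero hD0
  have hφpos : (0 : ℝ) < (Nat.totient (wCut k B * B) : ℝ) := by
    exact_mod_cast Nat.totient_pos.2 (Nat.pos_of_ne_zero hD0)
  rw [mul_assoc, hlim, ← mul_assoc]
  have h1 : ((wCut k B * B : ℕ) : ℝ) ^ k / (Nat.totient (wCut k B * B) : ℝ) ^ k *
      ((Nat.totient (wCut k B * B) : ℝ) / (wCut k B * B : ℕ)) ^ k = 1 := by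
    rw [← div_pow, ← mul_pow, div_mul_div_comm, mul_comm (((wCut k B * B : ℕ) : ℝ)),
      div_self (mul_pos hφpos hDpos).ne', one_pow]
  rw [h1, one_mul]

/-! ### In the frame of Prop. 6.1: `excProd = 1 + O(1/log X)` -/

/-- Growth bookkeeping for the frame: for large `x`, `k ≤ (log x)^{1/5}`, `x/2 ≤ X ≤ x log²x`, `R ≥ X^{1/30}`:
`⌊R⌋ ≥ 2`, `log x ≤ 2 log X`, `log X ≤ 3 log x`, `1 ≤ log X` and `60 k³ log²x ≤ ⌊R⌋ log⌊R⌋`.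
[cite: FordGreenKonyaginMaynardTao2018, Thm 6 p. 21 (ranges of k, X, R); Maynard2016DenseClusters, Lemma 8.1 p. 15] -/
theorem eventually_excProd_aux :
    ∀ᶠ x : ℕ in atTop, ∀ k : ℕ, (k : ℝ) ≤ Real.log x ^ ((1 : ℝ) / 5) → ∀ X R : ℝ,
      (x : ℝ) / 2 ≤ X → X ≤ x * Real.log x ^ 2 → X ^ ((1 : ℝ) / 30) ≤ R →
        2 ≤ ⌊R⌋₊ ∧ Real.log x ≤ 2 * Real.log X ∧ Real.log X ≤ 3 * Real.log x ∧ 1 ≤ Real.log X ∧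
          (60 : ℝ) * k ^ 3 * Real.log x ^ 2 ≤ ⌊R⌋₊ * Real.log ⌊R⌋₊ := by
  have hP : Tendsto (fun x : ℕ => (x : ℝ) ^ ((1 : ℝ) / 30)) atTop atTop :=
    (tendsto_rpow_atTop (by norm_num)).comp tendsto_natCast_atTop_atTop
  have ho := isLittleO_log_rpow_rpow_atTop ((13 : ℝ) / 5) (by norm_num : (0 : ℝ) < 1 / 30)
  filter_upwards [hP.eventually_ge_atTop 8, eventually_ge_atTop 8,
    tendsto_natCast_atTop_atTop.eventually (ho.bound (by norm_num : (0 : ℝ) < 1 / 480))]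
    with x hx8 hx8n h135 k hk X R hX hX2 hR
  have hx6' : (8 : ℝ) ≤ x := by exact_mod_cast hx8n
  have hx0 : (0 : ℝ) < x := by linarith
  set ℓ := Real.log (x : ℝ) with hℓ
  have he3 : Real.exp 1 ≤ 3 := Real.exp_one_lt_d9.le.trans (by norm_num)
  have hℓ1 : 1 ≤ ℓ := by
    rw [hℓ, Real.le_log_iff_exp_le (by linarith)]
    linarith
  have hℓ0 : 0 ≤ ℓ := zero_le_one.trans hℓ1
  have hℓx : ℓ ≤ x := Real.log_le_self hx0.le
  set P := (x : ℝ) ^ ((1 : ℝ) / 30) with hPdef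
  have hP0 : 0 ≤ P := Real.rpow_nonneg hx0.le _
  rw [Real.norm_of_nonneg (Real.rpow_nonneg hℓ0 _), Real.norm_of_nonneg hP0] at h135
  -- `⌊R⌋ ≥ P/4`
  have hR' : P / 2 ≤ R := by
    have h1 : ((x : ℝ) / 2) ^ ((1 : ℝ) / 30) ≤ R :=
      (Real.rpow_le_rpow (by positivity) hX (by norm_num)).trans hR
    have h2 : ((x : ℝ) / 2) ^ ((1 : ℝ) / 30) = P / (2 : ℝ) ^ ((1 : ℝ) / 30) := by
      rw [hPdef, Real.div_rpow hx0.le (by norm_num)]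
    have h3 : (2 : ℝ) ^ ((1 : ℝ) / 30) ≤ 2 := by
      conv_rhs => rw [← Real.rpow_one 2]
      exact Real.rpow_le_rpow_of_exponent_le (by norm_num) (by norm_num)
    have h4 : P / 2 ≤ P / (2 : ℝ) ^ ((1 : ℝ) / 30) :=
      div_le_div_of_nonneg_left hP0 (by positivity) h3
    linarith
  set N := ⌊R⌋₊ with hN
  have hNR : R < (N : ℝ) + 1 := Nat.lt_floor_add_one R
  have hNP : P / 4 ≤ (N : ℝ) := by linarith
  have hN2r : (2 : ℝ) ≤ N := by linarith
  have hN2 : 2 ≤ N := by exact_mod_cast hN2r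
  -- `X`-logarithms
  have hX0 : 0 < X := by linarith
  have hlogX_lo : Real.log x - Real.log 2 ≤ Real.log X := by
    rw [← Real.log_div hx0.ne' (by norm_num)]
    exact Real.log_le_log (by positivity) hX
  have hlog2 : Real.log 2 ≤ 1 := by
    have := Real.log_two_lt_d9; linarith
  have hℓ2 : 2 ≤ ℓ := by
    rw [hℓ, Real.le_log_iff_exp_le hx0]
    have h := Real.exp_one_lt_d9
    have h0 := Real.exp_pos 1
    have h2 : Real.exp 2 = Real.exp 1 * Real.exp 1 := by rw [← Real.exp_add]; norm_num
    have : Real.exp 2 ≤ 8 := by rw [h2]; nlinarith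
    linarith
  have hA : ℓ ≤ 2 * Real.log X := by rw [hℓ] at hℓ2 ⊢; linarith
  have hB : Real.log X ≤ 3 * ℓ := by
    have hX3 : X ≤ (x : ℝ) ^ 3 := by
      have hl2 : ℓ ^ 2 ≤ (x : ℝ) ^ 2 := pow_le_pow_left₀ hℓ0 hℓx 2
      calc X ≤ x * ℓ ^ 2 := hX2
        _ ≤ x * (x : ℝ) ^ 2 := mul_le_mul_of_nonneg_left hl2 hx0.le
        _ = (x : ℝ) ^ 3 := by ring
    calc Real.log X ≤ Real.log ((x : ℝ) ^ 3) := Real.log_le_log hX0 hX3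
      _ = 3 * ℓ := by rw [Real.log_pow, hℓ]; norm_num
  have hC : 1 ≤ Real.log X := by linarith
  -- `k³ ℓ² ≤ ℓ^{13/5} ≤ P/480`
  have hk0 : (0 : ℝ) ≤ k := Nat.cast_nonneg k
  have hk3 : (k : ℝ) ^ 3 ≤ ℓ ^ ((3 : ℝ) / 5) := by
    have h := pow_le_pow_left₀ hk0 hk 3
    rw [← Real.rpow_natCast (ℓ ^ ((1 : ℝ) / 5)) 3, ← Real.rpow_mul hℓ0] at h
    norm_num at h
    exact h
  have h135' : ℓ ^ ((3 : ℝ) / 5) * ℓ ^ 2 = ℓ ^ ((13 : ℝ) / 5) := by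
    rw [← Real.rpow_natCast ℓ 2, ← Real.rpow_add (by linarith)]; norm_num
  refine ⟨hN2, hA, hB, hC, ?_⟩
  have hlogN : Real.log 2 ≤ Real.log N := Real.log_le_log (by norm_num) hN2r
  have hl2 : (1 : ℝ) / 2 ≤ Real.log 2 := by linarith [Real.log_two_gt_d9]
  have hNlog : (N : ℝ) * (1 / 2) ≤ N * Real.log N :=
    mul_le_mul_of_nonneg_left (hl2.trans hlogN) (by linarith)
  calc (60 : ℝ) * k ^ 3 * ℓ ^ 2 = 60 * ((k : ℝ) ^ 3 * ℓ ^ 2) := by ring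
    _ ≤ 60 * (ℓ ^ ((3 : ℝ) / 5) * ℓ ^ 2) :=
        mul_le_mul_of_nonneg_left (mul_le_mul_of_nonneg_right hk3 (by positivity)) (by norm_num)
    _ = 60 * ℓ ^ ((13 : ℝ) / 5) := by rw [h135']
    _ ≤ 60 * (1 / 480 * P) := mul_le_mul_of_nonneg_left h135 (by norm_num)
    _ = (P / 4) * (1 / 2) := by ring
    _ ≤ N * (1 / 2) := mul_le_mul_of_nonneg_right hNP (by norm_num)
    _ ≤ N * Real.log N := hNlog

/-- **`Π` in the frame of Prop. 6.1 / [FGKMT, Thm 6]**: for all large `x`, uniformly in the data of the frame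
(`B = 1` or prime, `2 ≤ k ≤ (log x)^{1/5}`, admissible non-degenerate `𝓛` with `|aᵢ| ≤ log x`, `|bᵢ| ≤ x log²x`,
`x/2 ≤ X ≤ x log²x`, `X^{1/30} ≤ R ≤ X^{1/9}`), there is an exceptional modulus `E ≥ 1` (`ω(p) = k` off `E`,
Lemma 8.1) with `log E ≤ 20k² log X`, `2k·#{p ∣ E : p > ⌊R⌋}·log X ≤ ⌊R⌋`, and
`(WB)^k/φ(WB)^k · 𝔖_{WB}(𝓛) · Π = excProd ∈ [1, 1 + 1/log X]`.
[cite: Maynard2016DenseClusters, proof of Prop. 9.1 (9.4) p. 20, Lemma 8.1 p. 15; FordGreenKonyaginMaynardTao2018, Thm 6 (7.12) pp. 21–22] -/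
theorem prop91_excProd_frame :
    Prop61Frame 2 fun B k L X R => ∃ E : ℕ, 1 ≤ E ∧ (∀ p : ℕ, p.Prime → ¬ p ∣ E → omegaL L p = k) ∧
      Real.log E ≤ 20 * (k : ℝ) ^ 2 * Real.log X ∧
      2 * (k : ℝ) * #(E.primeFactors.filter (fun p => ⌊R⌋₊ < p)) * Real.log X ≤ ⌊R⌋₊ ∧
      ((wCut k B * B : ℕ) : ℝ) ^ k / (Nat.totient (wCut k B * B) : ℝ) ^ k *
          singSeriesExcl L (wCut k B * B) *
          MaynardDense.piRec k (idxMod L B R) (fun p => (p : ℝ) - omegaL L p) =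
        excProd L (wCut k B * B) ⌊R⌋₊ E ∧
      1 ≤ excProd L (wCut k B * B) ⌊R⌋₊ E ∧
      excProd L (wCut k B * B) ⌊R⌋₊ E ≤ 1 + 1 / Real.log X := by
  unfold Prop61Frame
  filter_upwards [eventually_excProd_aux, eventually_ge_atTop 3] with x hx hx3 B hB hBx k L X R hCk hk
    hadm hnd hcoef hX1 hX2 hR1 hR2
  obtain ⟨hN2, hℓX, hXℓ, hlogX1, hmain⟩ := hx k hk X R hX1 hX2 hR1
  have hB0 : B ≠ 0 := hB.elim (fun h => by rw [h]; exact one_ne_zero) fun h => h.ne_zero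
  have hx3' : (3 : ℝ) ≤ x := by exact_mod_cast hx3
  have hx0 : (0 : ℝ) < x := by linarith
  set ℓ := Real.log (x : ℝ) with hℓ
  have hℓ1 : 1 ≤ ℓ := by
    rw [hℓ, Real.le_log_iff_exp_le (by linarith)]
    exact (Real.exp_one_lt_d9.le.trans (by norm_num)).trans hx3'
  have hℓ0 : 0 ≤ ℓ := zero_le_one.trans hℓ1
  have hℓx : ℓ ≤ x := Real.log_le_self hx0.le
  -- the exceptional modulus with `M = 2x log³x`
  set M := 2 * (x : ℝ) * ℓ ^ 3 with hM
  have hM1 : 1 ≤ M := by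
    have : (1 : ℝ) ≤ ℓ ^ 3 := one_le_pow₀ hℓ1
    rw [hM]; nlinarith
  have haM : ∀ i, |(((L i).1 : ℤ) : ℝ)| ≤ M := by
    intro i
    refine (hcoef i).1.trans ?_
    have : ℓ ^ 3 = ℓ * ℓ ^ 2 := by ring
    have h2 : (1 : ℝ) ≤ ℓ ^ 2 := one_le_pow₀ hℓ1
    rw [hM]; nlinarith
  have hcM : ∀ i j, i ≠ j →
      |(((L i).1 : ℤ) : ℝ) * (((L j).2 : ℤ) : ℝ) - (((L j).1 : ℤ) : ℝ) * (((L i).2 : ℤ) : ℝ)| ≤ M := by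
    intro i j _
    have h1 := abs_sub (((((L i).1 : ℤ) : ℝ)) * (((L j).2 : ℤ) : ℝ))
      ((((L j).1 : ℤ) : ℝ) * (((L i).2 : ℤ) : ℝ))
    rw [abs_mul, abs_mul] at h1
    have hi := hcoef i
    have hj := hcoef j
    have e1 : |(((L i).1 : ℤ) : ℝ)| * |(((L j).2 : ℤ) : ℝ)| ≤ ℓ * (x * ℓ ^ 2) :=
      mul_le_mul hi.1 hj.2 (abs_nonneg _) hℓ0
    have e2 : |(((L j).1 : ℤ) : ℝ)| * |(((L i).2 : ℤ) : ℝ)| ≤ ℓ * (x * ℓ ^ 2) :=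
      mul_le_mul hj.1 hi.2 (abs_nonneg _) hℓ0
    calc _ ≤ ℓ * (x * ℓ ^ 2) + ℓ * (x * ℓ ^ 2) := h1.trans (add_le_add e1 e2)
      _ = M := by rw [hM]; ring
  obtain ⟨E, hE1, hE, hEle⟩ := exists_exceptional_modulus hadm hnd hM1 haM hcM
  have hE0 : E ≠ 0 := by omega
  -- `log E ≤ 10 k² log x ≤ 20 k² log X`
  set N := ⌊R⌋₊ with hN
  set b := #(E.primeFactors.filter (fun p => N < p)) with hb
  have hN2r : (2 : ℝ) ≤ N := by exact_mod_cast hN2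
  have hlogN : 0 < Real.log N := Real.log_pos (by linarith)
  have hMx : M ≤ (x : ℝ) ^ 5 := by
    have h2x : 2 * (x : ℝ) ≤ x ^ 2 := by nlinarith
    have hl3 : ℓ ^ 3 ≤ (x : ℝ) ^ 3 := pow_le_pow_left₀ hℓ0 hℓx 3
    calc M = 2 * (x : ℝ) * ℓ ^ 3 := hM
      _ ≤ (x : ℝ) ^ 2 * (x : ℝ) ^ 3 := mul_le_mul h2x hl3 (by positivity) (by positivity)
      _ = (x : ℝ) ^ 5 := by ring
  have hlogM : Real.log M ≤ 5 * ℓ := by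
    calc Real.log M ≤ Real.log ((x : ℝ) ^ 5) := Real.log_le_log (by linarith) hMx
      _ = 5 * ℓ := by rw [Real.log_pow, hℓ]; norm_num
  have hk0 : (0 : ℝ) ≤ k := Nat.cast_nonneg k
  have hkk : (((k + 1) * k : ℕ) : ℝ) ≤ 2 * (k : ℝ) ^ 2 := by
    have : (k + 1) * k ≤ 2 * k ^ 2 := by nlinarith
    exact_mod_cast this
  have hlogE : Real.log E ≤ 10 * (k : ℝ) ^ 2 * ℓ := by
    have hE1r : (0 : ℝ) < E := by exact_mod_cast hE1
    calc Real.log E ≤ Real.log (M ^ ((k + 1) * k)) := Real.log_le_log hE1r hEle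
      _ = ((k + 1) * k : ℕ) * Real.log M := by rw [Real.log_pow]
      _ ≤ ((k + 1) * k : ℕ) * (5 * ℓ) := mul_le_mul_of_nonneg_left hlogM (Nat.cast_nonneg _)
      _ ≤ 2 * (k : ℝ) ^ 2 * (5 * ℓ) := mul_le_mul_of_nonneg_right hkk (by positivity)
      _ = 10 * (k : ℝ) ^ 2 * ℓ := by ring
  have hlogE' : Real.log E ≤ 20 * (k : ℝ) ^ 2 * Real.log X := by
    calc Real.log E ≤ 10 * (k : ℝ) ^ 2 * ℓ := hlogE
      _ ≤ 10 * (k : ℝ) ^ 2 * (2 * Real.log X) := mul_le_mul_of_nonneg_left hℓX (by positivity)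
      _ = 20 * (k : ℝ) ^ 2 * Real.log X := by ring
  -- `2k · b · log X ≤ N`
  have hbnd : (b : ℝ) * Real.log N ≤ 10 * (k : ℝ) ^ 2 * ℓ :=
    (card_primeFactors_filter_mul_log_le hE0 N).trans hlogE
  have hcount : 2 * (k : ℝ) * b * Real.log X ≤ N := by
    have hreal : (2 * (k : ℝ) * b * Real.log X) * Real.log N ≤ N * Real.log N := by
      calc (2 * (k : ℝ) * b * Real.log X) * Real.log N
            = 2 * (k : ℝ) * Real.log X * ((b : ℝ) * Real.log N) := by ring
        _ ≤ 2 * (k : ℝ) * Real.log X * (10 * (k : ℝ) ^ 2 * ℓ) :=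
            mul_le_mul_of_nonneg_left hbnd (by positivity)
        _ ≤ 2 * (k : ℝ) * (3 * ℓ) * (10 * (k : ℝ) ^ 2 * ℓ) := by
            have : 2 * (k : ℝ) * Real.log X ≤ 2 * (k : ℝ) * (3 * ℓ) :=
              mul_le_mul_of_nonneg_left hXℓ (by positivity)
            exact mul_le_mul_of_nonneg_right this (by positivity)
        _ = 60 * (k : ℝ) ^ 3 * ℓ ^ 2 := by ring
        _ ≤ N * Real.log N := hmain
    exact le_of_mul_le_mul_right hreal hlogN
  refine ⟨E, hE1, hE, hlogE', hcount, prefactor_mul_piRec_eq hCk hadm hnd hB0 R hE0 hE,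
    one_le_excProd hadm _ _ _, ?_⟩
  -- `excProd ≤ exp(k b/(N+1)) ≤ 1 + 2 k b/(N+1) ≤ 1 + 1/log X`
  have hlX0 : 0 < Real.log X := by linarith
  set t : ℝ := (k : ℝ) * b / ((N : ℝ) + 1) with ht
  have ht0 : 0 ≤ t := by positivity
  have ht1 : 2 * t * Real.log X ≤ 1 := by
    have hN1 : (0 : ℝ) < (N : ℝ) + 1 := by positivity
    rw [ht]
    rw [show 2 * ((k : ℝ) * b / ((N : ℝ) + 1)) * Real.log X =
      (2 * (k : ℝ) * b * Real.log X) / ((N : ℝ) + 1) by ring, div_le_one hN1]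
    linarith
  have htle : t ≤ 1 := by nlinarith
  have hexp : Real.exp t ≤ 1 + 2 * t := by
    have h := Real.abs_exp_sub_one_le (x := t) (by rw [abs_of_nonneg ht0]; exact htle)
    rw [abs_of_nonneg ht0] at h
    have := (abs_le.1 h).2
    linarith
  calc excProd L (wCut k B * B) N E ≤ Real.exp t := excProd_le_exp hadm _ _ _
    _ ≤ 1 + 2 * t := hexp
    _ ≤ 1 + 1 / Real.log X := by
        have : 2 * t ≤ 1 / Real.log X := by rw [le_div_iff₀ hlX0]; exact ht1
        linarith

end Literature.NumberTheory.Sieve.FGKMT2018
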